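import Literature.NumberTheory.Transcendental.RivoalSeriesStirling
import Literature.NumberTheory.Transcendental.OddZetaSeries
import HarnessLib

/-!
# Rivoal's very-well-poised series — asymptotics of `S_n^{1/n}`

Topic `Literature/NumberTheory/Transcendental`. Everything in this file is PROVED.

Rivoal (2000, Lemme 3) / Ball–Rivoal (2001, Lemme 3) need, for Nesterenko's criterion, that
`lim_n |S_n|^{1/n}` EXISTS and is small, where `S_n = ∑_{k ≥ 1} R_n(k)` is the series of
`RivoalSeriesDefs.lean`. We give an elementary proof (max-term method + the uniform Stirling
estimate of `RivoalSeriesStirling.lean`):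

* `Rfun_one_eq_ratfun`: the tree's Fischler–Sprang–Zudilin function `OddZeta.Rfun r 1 a n`
  (`OddZetaSeries.lean`, `D = 1`) IS Rivoal's `R_n` (`ratfun a r n`); hence summability and
  positivity of the series (`summable_ratfun_succ`, `series_pos`);
* `Phi_le`: `Φ(x) ≤ −(a−2r) log(x+1) + (2r+1)(1+log 2)` for `x ≥ r`;
* `series_ge_exp`: for `x₀ ≥ r`, `S_n ≥ exp(n(Φ(x₀) − ε))` for large `n` (one term `k ≈ x₀ n`);
* `series_le_exp`: if `Φ ≤ M` on `[r, ∞)` then `S_n ≤ exp(n(M + ε))` for large `n`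
  (terms `k ≤ Kn` by `Φ ≤ M`, tail by the decay of `Φ` and `∑_{j > N} j^{-s} ≤ N^{1-s}`);
* `tendsto_series_rpow`: **`S_n^{1/n} → s := exp(sup_{x ≥ r} Φ)`**, with
  `0 < s ≤ (2e)^{2r+1}/(r+1)^{a−2r}` — our form of Rivoal's Lemme 3 (whose sharper bound
  `(2r+1)^{2r+1}(ra+r)^{ra+r}(a−2r)^{a−2r}/(ra+a−r)^{ra+a−r}` is not needed for Théorème 1:
  only `log s ≤ −a log r (1+o(1)) + O(a) + O(r log r)` matters).

## References

* T. Rivoal, C. R. Acad. Sci. Paris 331 (2000) 267–270, Lemme 3. [Rivoal2000]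
* K. Ball, T. Rivoal, Invent. Math. 146 (2001) 193–207, Lemme 3. [BallRivoal2001]
* S. Fischler, Sém. Bourbaki 910, Astérisque 294 (2004), Lemme 2.9 and Remarque 2.10
  ("il suffit de connaître l'existence de la limite … et sa majoration"). [Fischler2004]
-/

noncomputable section

open Finset Real Filter
open scoped Nat Topology

namespace Literature.NumberTheory.Transcendental

namespace RivoalSeries

/-! ### The bridge to `OddZeta.Rfun` -/

/-- Splitting a product over `range (u + v + w)` into three blocks. [folklore] -/
theorem prod_range_three (f : ℕ → ℝ) (u v w : ℕ) :
    ∏ l ∈ range (u + v + w), f l =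
      (∏ l ∈ range u, f l) * (∏ q ∈ range v, f (u + q)) * ∏ q ∈ range w, f (u + v + q) := by
  rw [prod_range_add, prod_range_add]

/-- **Bridge.** The Fischler–Sprang–Zudilin rational function of the tree with `D = 1`,
`OddZeta.Rfun r 1 a n`, is Rivoal's `R_n` (`ratfun a r n`): the numerator
`∏_{l=0}^{(2r+1)n}(t − rn + l)` is `(t−rn)_{rn} (t)_{n+1} (t+n+1)_{rn}` and one power of
`(t)_{n+1}` cancels. [cite: Rivoal2000, §1] -/
theorem Rfun_one_eq_ratfun (a r n : ℕ) (ha : 1 ≤ a) (t : ℝ) :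
    OddZeta.Rfun r 1 a n t = ratfun a r n t := by
  unfold OddZeta.Rfun OddZeta.Lnum ratfun
  set P := ∏ q ∈ range (n + 1), (t + q) with hP
  have hL : (2 * r + 1) * 1 * n + 1 = r * n + (n + 1) + r * n := by ring
  have hnum : ∏ l ∈ range ((2 * r + 1) * 1 * n + 1), (t - r * n + (l : ℝ) / ((1 : ℕ) : ℝ)) =
      (∏ q ∈ range (r * n), (t - r * n + q)) * P * ∏ q ∈ range (r * n), (t + n + 1 + q) := by
    rw [hL, prod_range_three]
    congr 1
    · congr 1
      · refine prod_congr rfl fun q _ => ?_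
        push_cast; ring
      · rw [hP]
        refine prod_congr rfl fun q _ => ?_
        push_cast; ring
    · refine prod_congr rfl fun q _ => ?_
      push_cast; ring
  have hden : ∏ k ∈ range (n + 1), (t + k) ^ (a + 1) = P ^ a * P := by
    rw [prod_pow, ← hP, pow_succ]
  have hexp : a + 1 - (2 * r + 1) * 1 = a - 2 * r := by omega
  rw [hnum, hden, hexp]
  simp only [Nat.cast_one, one_pow, one_mul]
  by_cases hP0 : P = 0
  · simp [hP0, zero_pow (by omega : a ≠ 0)]
  · field_simp

/-- Summability of `k ↦ R_n(k+1)` for `n ≥ 1`, `2r + 2 ≤ a` (from the tree's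
`OddZeta.summable_Rfun`). [folklore] -/
theorem summable_ratfun_succ (a r n : ℕ) (hn : 1 ≤ n) (ha : 2 * r + 2 ≤ a) :
    Summable (fun k : ℕ => ratfun a r n ((k + 1 : ℕ) : ℝ)) := by
  have h := OddZeta.summable_Rfun (r := r) (D := 1) (s := a) (n := n) hn one_pos
    (by omega) (α := 0) le_rfl
  refine h.congr fun k => ?_
  rw [add_zero, Rfun_one_eq_ratfun a r n (by omega)]
  push_cast; ring_nf

/-- The series with the casts normalised. [folklore] -/
theorem series_eq (a r n : ℕ) : series a r n = ∑' k : ℕ, ratfun a r n ((k + 1 : ℕ) : ℝ) := by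
  unfold series
  refine tsum_congr fun k => ?_
  push_cast; ring_nf

/-- `S_n > 0` for `n ≥ 1`, `2r + 2 ≤ a`. [cite: Rivoal2000, §1] -/
theorem series_pos (a r n : ℕ) (hn : 1 ≤ n) (ha : 2 * r + 2 ≤ a) : 0 < series a r n := by
  rw [series_eq]
  exact (summable_ratfun_succ a r n hn ha).tsum_pos (fun k => ratfun_succ_nonneg a r n k)
    (r * n) (ratfun_succ_pos a r n (r * n) le_rfl)

/-- One term bounds the series from below. [folklore] -/
theorem ratfun_le_series (a r n : ℕ) (hn : 1 ≤ n) (ha : 2 * r + 2 ≤ a) (k : ℕ) :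
    ratfun a r n ((k + 1 : ℕ) : ℝ) ≤ series a r n := by
  rw [series_eq]
  exact (summable_ratfun_succ a r n hn ha).le_tsum k fun j _ => ratfun_succ_nonneg a r n j

/-! ### Bounds for `Φ` -/

/-- Shift bound for `φ(y) = y log y` including `y = 0`: for `y, h ≥ 0`, `y + h ≥ 1`,
`φ(y+h) − φ(y) ≤ h (1 + log(y+h))`. [folklore] -/
theorem mul_log_shift' {y h : ℝ} (hy : 0 ≤ y) (hh : 0 ≤ h) (h1 : 1 ≤ y + h) :
    (y + h) * Real.log (y + h) - y * Real.log y ≤ h * (1 + Real.log (y + h)) := by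
  rcases eq_or_lt_of_le hy with rfl | hy'
  · simp only [zero_add, zero_mul, sub_zero]
    have := Real.log_nonneg (by simpa using h1 : (1 : ℝ) ≤ h)
    nlinarith
  · exact (mul_log_shift hy' hh h1).2

/-- **Decay of `Φ`.** For `x ≥ r` and `2r ≤ a`:
`Φ(x) ≤ −(a − 2r) log(x+1) + (2r+1)(1 + log 2)`. [folklore] -/
theorem Phi_le (a r : ℕ) {x : ℝ} (hx : (r : ℝ) ≤ x) :
    Phi a r x ≤ -((a : ℝ) - 2 * r) * Real.log (x + 1) + (2 * r + 1) * (1 + Real.log 2) := by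
  have hr0 : (0 : ℝ) ≤ r := Nat.cast_nonneg r
  have hx0 : 0 ≤ x := hr0.trans hx
  have p1 : x * Real.log x - (x + 1) * Real.log (x + 1) ≤ -Real.log (x + 1) := by
    have : x * Real.log x ≤ x * Real.log (x + 1) := by
      rcases eq_or_lt_of_le hx0 with h | hx'
      · rw [← h]; simp
      · exact mul_le_mul_of_nonneg_left (Real.log_le_log hx' (by linarith)) hx0
    linarith
  have p2 : (x + r + 1) * Real.log (x + r + 1) - (x - r) * Real.log (x - r) ≤
      (2 * r + 1) * (1 + Real.log (x + r + 1)) := by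
    have := mul_log_shift' (y := x - r) (h := 2 * r + 1) (by linarith) (by positivity) (by linarith)
    have e : x - r + (2 * r + 1) = x + r + 1 := by ring
    rw [e] at this; exact this
  have p3 : Real.log (x + r + 1) ≤ Real.log (x + 1) + Real.log 2 := by
    rw [← Real.log_mul (by linarith) (by norm_num)]
    exact Real.log_le_log (by linarith) (by linarith)
  have q1 := mul_le_mul_of_nonneg_left p1 (by positivity : (0 : ℝ) ≤ a + 1)
  have q3 := mul_le_mul_of_nonneg_left p3 (by positivity : (0 : ℝ) ≤ 2 * r + 1)
  unfold Phi
  linarith [q1, p2, q3]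

/-- `Φ ≤ −(a−2r) log(r+1) + (2r+1)(1+log 2)` on `[r, ∞)`. [folklore] -/
theorem Phi_le_const (a r : ℕ) (h2r : 2 * r ≤ a) {x : ℝ} (hx : (r : ℝ) ≤ x) :
    Phi a r x ≤ -((a : ℝ) - 2 * r) * Real.log (r + 1) + (2 * r + 1) * (1 + Real.log 2) := by
  have h := Phi_le a r hx
  have hlog : Real.log (r + 1) ≤ Real.log (x + 1) := Real.log_le_log (by positivity) (by linarith)
  have ha : (0 : ℝ) ≤ (a : ℝ) - 2 * r := by
    have : ((2 * r : ℕ) : ℝ) ≤ a := by exact_mod_cast h2r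
    push_cast at this; linarith
  nlinarith

/-- `Φ` is continuous. [folklore] -/
theorem continuous_Phi (a r : ℕ) : Continuous (Phi a r) := by
  have hc : Continuous fun y : ℝ => y * Real.log y := Real.continuous_mul_log
  unfold Phi
  fun_prop

/-! ### Growth lemmas -/

/-- `log n ≤ δ n` for large `n`. [folklore] -/
theorem eventually_log_le_mul {δ : ℝ} (hδ : 0 < δ) : ∀ᶠ n : ℕ in atTop, Real.log n ≤ δ * n := by
  have h := Real.isLittleO_log_id_atTop.bound hδ
  have h2 := tendsto_natCast_atTop_atTop.eventually h
  filter_upwards [h2] with n hn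
  have h3 : |Real.log n| ≤ δ * |(n : ℝ)| := by simpa using hn
  rw [Nat.abs_cast n] at h3
  exact (le_abs_self _).trans h3

/-- `A n^D ≤ exp(ε n)` for large `n` (`A, ε > 0`). [folklore] -/
theorem eventually_mul_pow_le_exp {A ε : ℝ} (hA : 0 < A) (hε : 0 < ε) (D : ℕ) :
    ∀ᶠ n : ℕ in atTop, A * (n : ℝ) ^ D ≤ Real.exp (ε * n) := by
  have hD1 : (0 : ℝ) < D + 1 := by positivity
  filter_upwards [eventually_log_le_mul (δ := ε / (2 * (D + 1))) (by positivity),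
    tendsto_natCast_atTop_atTop.eventually_ge_atTop (2 * Real.log A / ε),
    eventually_ge_atTop 1] with n h1 h2 h3
  have hn : (0 : ℝ) < n := by exact_mod_cast h3
  have e : A * (n : ℝ) ^ D = Real.exp (Real.log A + D * Real.log n) := by
    rw [Real.exp_add, Real.exp_log hA, Real.exp_nat_mul, Real.exp_log hn]
  rw [e, Real.exp_le_exp]
  have h4 : (D : ℝ) * Real.log n ≤ D * (ε / (2 * (D + 1)) * n) :=
    mul_le_mul_of_nonneg_left h1 (Nat.cast_nonneg D)
  have h5 : (D : ℝ) * (ε / (2 * (D + 1)) * n) ≤ ε / 2 * n := by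
    rw [show (D : ℝ) * (ε / (2 * (D + 1)) * n) = (D / (D + 1)) * (ε / 2 * n) by field_simp]
    have : (D : ℝ) / (D + 1) ≤ 1 := (div_le_one hD1).mpr (by linarith)
    exact mul_le_of_le_one_left (by positivity) this
  have h6 : Real.log A ≤ ε / 2 * n := by
    rw [div_le_iff₀ hε] at h2; linarith
  linarith

/-! ### The lower bound: one term -/

/-- `⌈x₀ n⌉/n → x₀`. [folklore] -/
theorem tendsto_ceil_div {x₀ : ℝ} (hx₀ : 0 ≤ x₀) :
    Tendsto (fun n : ℕ => (⌈x₀ * n⌉₊ : ℝ) / n) atTop (𝓝 x₀) := by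
  have hup : Tendsto (fun n : ℕ => x₀ + 1 / (n : ℝ)) atTop (𝓝 x₀) := by
    have h := (tendsto_const_nhds (x := x₀) (f := (atTop : Filter ℕ))).add
      tendsto_one_div_atTop_nhds_zero_nat
    rwa [add_zero] at h
  refine tendsto_of_tendsto_of_tendsto_of_le_of_le' tendsto_const_nhds hup ?_ ?_
  · filter_upwards [eventually_ge_atTop 1] with n hn
    have hn' : (0 : ℝ) < n := by exact_mod_cast hn
    rw [le_div_iff₀ hn']
    exact Nat.le_ceil _
  · filter_upwards [eventually_ge_atTop 1] with n hn
    have hn' : (0 : ℝ) < n := by exact_mod_cast hn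
    rw [div_le_iff₀ hn', add_mul, one_div_mul_cancel hn'.ne']
    exact (Nat.ceil_lt_add_one (by positivity)).le

/-- **Lower bound.** For `x₀ ≥ r` and `ε > 0`: `S_n ≥ exp(n(Φ(x₀) − ε))` for all large `n`
(the single term `k = ⌈x₀ n⌉` and the Stirling estimate). [cite: Rivoal2000, Lemme 3 (elementary form)] -/
theorem series_ge_exp (a r : ℕ) (ha : 2 * r + 2 ≤ a) {x₀ : ℝ} (hx₀ : (r : ℝ) ≤ x₀) {ε : ℝ}
    (hε : 0 < ε) : ∀ᶠ n : ℕ in atTop, Real.exp (n * (Phi a r x₀ - ε)) ≤ series a r n := by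
  have h2r : 2 * r ≤ a := by omega
  have hr0 : (0 : ℝ) ≤ r := Nat.cast_nonneg r
  have hx0 : 0 ≤ x₀ := hr0.trans hx₀
  set C : ℝ := 6 * ((a : ℝ) + 2) with hC
  have hC0 : 0 < C := by rw [hC]; positivity
  -- continuity of `Φ` at `x₀` along `⌈x₀ n⌉/n`
  have hΦ : ∀ᶠ n : ℕ in atTop, Phi a r x₀ - ε / 2 < Phi a r ((⌈x₀ * n⌉₊ : ℝ) / n) :=
    (((continuous_Phi a r).tendsto x₀).comp (tendsto_ceil_div hx0)).eventually_const_lt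
      (by linarith)
  -- the error term is `o(n)`
  have hB : 0 < x₀ + r + 4 := by linarith
  have herr : ∀ᶠ n : ℕ in atTop, C * (Real.log ((x₀ + r + 4) * n) + 1) ≤ ε / 2 * n := by
    filter_upwards [eventually_log_le_mul (δ := ε / (4 * C)) (by positivity),
      tendsto_natCast_atTop_atTop.eventually_ge_atTop (4 * C * (Real.log (x₀ + r + 4) + 1) / ε),
      eventually_ge_atTop 1] with n h1 h2 h3
    have hn : (0 : ℝ) < n := by exact_mod_cast h3
    rw [Real.log_mul hB.ne' hn.ne']
    rw [div_le_iff₀ hε] at h2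
    have h4 : C * Real.log n ≤ C * (ε / (4 * C) * n) := mul_le_mul_of_nonneg_left h1 hC0.le
    rw [show C * (ε / (4 * C) * n) = ε / 4 * n by field_simp] at h4
    nlinarith
  filter_upwards [hΦ, herr, eventually_ge_atTop 1] with n hΦn herrn hn
  have hn0 : (0 : ℝ) < n := by exact_mod_cast hn
  set k : ℕ := ⌈x₀ * n⌉₊ with hk
  have hkrn : r * n ≤ k := by
    have h1 : ((r * n : ℕ) : ℝ) ≤ x₀ * n := by
      push_cast; exact mul_le_mul_of_nonneg_right hx₀ hn0.le
    exact_mod_cast h1.trans (Nat.le_ceil _)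
  have hest := abs_log_ratfun_sub_le a r n k h2r hn hkrn
  rw [abs_le] at hest
  have hk1 : (k : ℝ) ≤ x₀ * n + 1 := (Nat.ceil_lt_add_one (by positivity)).le
  have hℓ : Real.log ((k : ℝ) + (r + 1) * n + 2) ≤ Real.log ((x₀ + r + 4) * n) := by
    refine Real.log_le_log (by positivity) ?_
    have hn1 : (1 : ℝ) ≤ n := by exact_mod_cast hn
    nlinarith
  have hℓ0 : 0 ≤ Real.log ((k : ℝ) + (r + 1) * n + 2) := Real.log_nonneg (by
    have : (0 : ℝ) ≤ k := Nat.cast_nonneg k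
    nlinarith)
  have hmain : (n : ℝ) * (Phi a r x₀ - ε) ≤ Real.log (ratfun a r n ((k + 1 : ℕ) : ℝ)) := by
    have e1 := hest.1
    have e2 : C * (Real.log ((k : ℝ) + (r + 1) * n + 2) + 1) ≤ ε / 2 * n :=
      (mul_le_mul_of_nonneg_left (by linarith) hC0.le).trans herrn
    have e3 : (n : ℝ) * (Phi a r x₀ - ε / 2) ≤ n * Phi a r ((k : ℝ) / n) :=
      mul_le_mul_of_nonneg_left hΦn.le hn0.le
    rw [hC] at e2
    nlinarith
  calc Real.exp (n * (Phi a r x₀ - ε)) ≤ Real.exp (Real.log (ratfun a r n ((k + 1 : ℕ) : ℝ))) :=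
        Real.exp_le_exp.mpr hmain
    _ = ratfun a r n ((k + 1 : ℕ) : ℝ) := Real.exp_log (ratfun_succ_pos a r n k hkrn)
    _ ≤ series a r n := ratfun_le_series a r n hn ha k

/-! ### The upper bound -/

/-- Telescoping: `∑_{j=M+1}^{N-1} (1/(j-1) − 1/j) ≤ 1/M`. [folklore] -/
theorem sum_Ico_telescope_le (M N : ℕ) (hM : 1 ≤ M) :
    ∑ j ∈ Ico (M + 1) N, (1 / ((j : ℝ) - 1) - 1 / j) ≤ 1 / M := by
  rw [Finset.sum_Ico_eq_sum_range]
  set g : ℕ → ℝ := fun i => 1 / ((M : ℝ) + i) with hg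
  have e : ∀ i : ℕ, (1 / (((M + 1 + i : ℕ) : ℝ) - 1) - 1 / ((M + 1 + i : ℕ) : ℝ)) =
      -(g (i + 1) - g i) := by
    intro i; simp only [hg]; push_cast; ring
  rw [Finset.sum_congr rfl (fun i _ => e i), Finset.sum_neg_distrib, Finset.sum_range_sub]
  simp only [hg, Nat.cast_zero, add_zero]
  have : 0 ≤ 1 / ((M : ℝ) + ((N - (M + 1) : ℕ) : ℝ)) := by positivity
  linarith

/-- **Tail sums.** For `M ≥ 1`, `s ≥ 2`: `∑_{j=M+1}^{N-1} j^{-s} ≤ M^{1-s}`. [folklore] -/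
theorem sum_Ico_inv_pow_le {M s : ℕ} (hM : 1 ≤ M) (hs : 2 ≤ s) (N : ℕ) :
    ∑ j ∈ Ico (M + 1) N, 1 / (j : ℝ) ^ s ≤ 1 / (M : ℝ) ^ (s - 1) := by
  obtain ⟨q, rfl⟩ : ∃ q, s = q + 2 := ⟨s - 2, by omega⟩
  rw [show q + 2 - 1 = q + 1 by omega]
  have hM0 : (0 : ℝ) < M := by exact_mod_cast hM
  have hterm : ∀ j ∈ Ico (M + 1) N,
      1 / (j : ℝ) ^ (q + 2) ≤ 1 / (M : ℝ) ^ q * (1 / ((j : ℝ) - 1) - 1 / j) := by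
    intro j hj
    have hj : M + 1 ≤ j := (mem_Ico.1 hj).1
    have hjM : (M : ℝ) + 1 ≤ j := by exact_mod_cast hj
    have hj0 : (0 : ℝ) < j := by linarith
    have hj1 : (0 : ℝ) < (j : ℝ) - 1 := by linarith
    have e : 1 / ((j : ℝ) - 1) - 1 / j = 1 / (j * (j - 1)) := by
      field_simp; ring
    rw [e, one_div_mul_one_div]
    apply one_div_le_one_div_of_le (by positivity)
    have h1 : (M : ℝ) ^ q ≤ (j : ℝ) ^ q := pow_le_pow_left₀ hM0.le (by linarith) q
    have h2 : (j : ℝ) * (j - 1) ≤ j ^ 2 := by nlinarith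
    calc (M : ℝ) ^ q * (j * (j - 1)) ≤ (j : ℝ) ^ q * j ^ 2 :=
          mul_le_mul h1 h2 (by positivity) (by positivity)
      _ = (j : ℝ) ^ (q + 2) := by rw [pow_add]
  calc ∑ j ∈ Ico (M + 1) N, 1 / (j : ℝ) ^ (q + 2)
      ≤ ∑ j ∈ Ico (M + 1) N, 1 / (M : ℝ) ^ q * (1 / ((j : ℝ) - 1) - 1 / j) := sum_le_sum hterm
    _ = 1 / (M : ℝ) ^ q * ∑ j ∈ Ico (M + 1) N, (1 / ((j : ℝ) - 1) - 1 / j) := by rw [mul_sum]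
    _ ≤ 1 / (M : ℝ) ^ q * (1 / M) :=
        mul_le_mul_of_nonneg_left (sum_Ico_telescope_le M N hM) (by positivity)
    _ = 1 / (M : ℝ) ^ (q + 1) := by rw [one_div_mul_one_div, pow_succ]

/-- The summand as an exponential, for `k ≥ rn`:
`R_n(k+1) ≤ exp(n Φ(k/n)) · e^{C} · (k + (r+1)n + 2)^{C}`, `C = 6(a+2)`. [folklore] -/
theorem ratfun_succ_le_exp (a r n k : ℕ) (h2r : 2 * r ≤ a) (hn : 1 ≤ n) (hk : r * n ≤ k) :
    ratfun a r n ((k + 1 : ℕ) : ℝ) ≤ Real.exp (n * Phi a r ((k : ℝ) / n)) *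
      (Real.exp (6 * ((a : ℝ) + 2)) * ((k : ℝ) + (r + 1) * n + 2) ^ (6 * (a + 2))) := by
  have hest := (abs_le.mp (abs_log_ratfun_sub_le a r n k h2r hn hk)).2
  have hpos := ratfun_succ_pos a r n k hk
  have hz : (0 : ℝ) < (k : ℝ) + (r + 1) * n + 2 := by positivity
  have hcast : (6 : ℝ) * ((a : ℝ) + 2) = ((6 * (a + 2) : ℕ) : ℝ) := by push_cast; ring
  have e : Real.exp (6 * ((a : ℝ) + 2)) * ((k : ℝ) + (r + 1) * n + 2) ^ (6 * (a + 2)) =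
      Real.exp (6 * ((a : ℝ) + 2) * (Real.log ((k : ℝ) + (r + 1) * n + 2) + 1)) := by
    rw [show (6 : ℝ) * ((a : ℝ) + 2) * (Real.log ((k : ℝ) + (r + 1) * n + 2) + 1) =
      6 * ((a : ℝ) + 2) * Real.log ((k : ℝ) + (r + 1) * n + 2) + 6 * ((a : ℝ) + 2) by ring,
      Real.exp_add, hcast, Real.exp_nat_mul, Real.exp_log hz, mul_comm]
  rw [e, ← Real.exp_add]
  calc ratfun a r n ((k + 1 : ℕ) : ℝ) = Real.exp (Real.log (ratfun a r n ((k + 1 : ℕ) : ℝ))) :=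
        (Real.exp_log hpos).symm
    _ ≤ _ := Real.exp_le_exp.mpr (by linarith)


/-- Partial sums under a two-regime bound: `f k ≤ B₁` for `k ≤ T` and
`f k ≤ B₂ (k+n)^{-s}` for `k > T` (`s ≥ 2`, `n ≥ 1`, `B₂ ≥ 0`, `f ≥ 0`) give
`∑_{k<N} f k ≤ (T+1) B₁ + B₂ (T+n)^{1-s}`. [folklore] -/
theorem sum_range_le_of_two_bounds {f : ℕ → ℝ} (hf : ∀ k, 0 ≤ f k) {T n s : ℕ} {B₁ B₂ : ℝ}
    (hn : 1 ≤ n) (hs : 2 ≤ s) (hB₂ : 0 ≤ B₂) (h1 : ∀ k, k ≤ T → f k ≤ B₁)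
    (h2 : ∀ k, T < k → f k ≤ B₂ * (1 / ((k : ℝ) + n) ^ s)) (N : ℕ) :
    ∑ k ∈ range N, f k ≤ (T + 1) * B₁ + B₂ * (1 / ((T : ℝ) + n) ^ (s - 1)) := by
  rw [← sum_filter_add_sum_filter_not (range N) (fun k => k ≤ T)]
  have hS1 : ∑ k ∈ (range N).filter (fun k => k ≤ T), f k ≤ (T + 1) * B₁ := by
    have hsub : (range N).filter (fun k => k ≤ T) ⊆ range (T + 1) := by
      intro k hk
      simp only [mem_filter, mem_range] at hk ⊢
      omega
    calc ∑ k ∈ (range N).filter (fun k => k ≤ T), f k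
        ≤ ∑ k ∈ range (T + 1), f k := sum_le_sum_of_subset_of_nonneg hsub fun k _ _ => hf k
      _ ≤ ∑ k ∈ range (T + 1), B₁ := sum_le_sum fun k hk => h1 k (by simpa [Nat.lt_succ_iff] using hk)
      _ = (T + 1) * B₁ := by rw [sum_const, card_range, nsmul_eq_mul]; push_cast; ring
  have hS2 : ∑ k ∈ (range N).filter (fun k => ¬ k ≤ T), f k ≤ B₂ * (1 / ((T : ℝ) + n) ^ (s - 1)) := by
    have hsub : (range N).filter (fun k => ¬ k ≤ T) ⊆ Ico (T + 1) N := by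
      intro k hk
      simp only [mem_filter, mem_range, mem_Ico] at hk ⊢
      omega
    have hTn : 1 ≤ T + n := by omega
    calc ∑ k ∈ (range N).filter (fun k => ¬ k ≤ T), f k
        ≤ ∑ k ∈ Ico (T + 1) N, f k := sum_le_sum_of_subset_of_nonneg hsub fun k _ _ => hf k
      _ ≤ ∑ k ∈ Ico (T + 1) N, B₂ * (1 / ((k : ℝ) + n) ^ s) :=
          sum_le_sum fun k hk => h2 k (by have := (mem_Ico.1 hk).1; omega)
      _ = B₂ * ∑ j ∈ Ico (T + 1 + n) (N + n), 1 / (j : ℝ) ^ s := by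
          rw [mul_sum, ← sum_Ico_add' (fun j : ℕ => B₂ * (1 / (j : ℝ) ^ s)) (T + 1) N n]
          refine sum_congr rfl fun k _ => ?_
          push_cast; rfl
      _ ≤ B₂ * (1 / ((T : ℝ) + n) ^ (s - 1)) := by
          refine mul_le_mul_of_nonneg_left ?_ hB₂
          have h := sum_Ico_inv_pow_le (M := T + n) (s := s) hTn hs (N + n)
          rw [show T + n + 1 = T + 1 + n by ring] at h
          exact_mod_cast h
  exact add_le_add hS1 hS2

/-- Head terms: for `k ≤ Kn` (and `Φ ≤ M` on `[r,∞)`),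
`R_n(k+1) ≤ e^{nM} · e^{C} ((K+r+3)n)^{C}`, `C = 6(a+2)`. [folklore] -/
theorem ratfun_succ_le_head (a r n k K : ℕ) {M : ℝ} (hM : ∀ x : ℝ, (r : ℝ) ≤ x → Phi a r x ≤ M)
    (h2r : 2 * r ≤ a) (hn : 1 ≤ n) (hk : k ≤ K * n) :
    ratfun a r n ((k + 1 : ℕ) : ℝ) ≤
      Real.exp (n * M) * (Real.exp (6 * ((a : ℝ) + 2)) * (((K : ℝ) + r + 3) * n) ^ (6 * (a + 2))) := by
  have hn0 : (0 : ℝ) < n := by exact_mod_cast hn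
  rcases lt_or_ge k (r * n) with hlt | hge
  · rw [ratfun_nat_eq_zero a r n (k := k + 1) (by omega) (by omega)]; positivity
  refine (ratfun_succ_le_exp a r n k h2r hn hge).trans ?_
  have hkn : (r : ℝ) ≤ (k : ℝ) / n := by
    rw [le_div_iff₀ hn0]; exact_mod_cast hge
  have e1 : Real.exp (n * Phi a r ((k : ℝ) / n)) ≤ Real.exp (n * M) :=
    Real.exp_le_exp.mpr (mul_le_mul_of_nonneg_left (hM _ hkn) hn0.le)
  have hkK' : (k : ℝ) ≤ K * n := by exact_mod_cast hk
  have hn1 : (1 : ℝ) ≤ n := by exact_mod_cast hn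
  have hle : (k : ℝ) + (r + 1) * n + 2 ≤ ((K : ℝ) + r + 3) * n := by nlinarith
  have e2 : ((k : ℝ) + (r + 1) * n + 2) ^ (6 * (a + 2)) ≤ (((K : ℝ) + r + 3) * n) ^ (6 * (a + 2)) :=
    pow_le_pow_left₀ (by positivity) hle _
  exact mul_le_mul e1 (mul_le_mul_of_nonneg_left e2 (Real.exp_pos _).le) (by positivity)
    (by positivity)

/-- Tail terms: for `k ≥ rn` and `6(a+2) ≤ pn` (`p = a − 2r`),
`R_n(k+1) ≤ [e^{c₁ n} n^{pn} e^{C} (r+3)^{C}] · (k+n)^{-(pn - C)}`, `c₁ = (2r+1)(1+log 2)`,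
`C = 6(a+2)` — from the decay `Φ(x) ≤ −p log(x+1) + c₁`. [folklore] -/
theorem ratfun_succ_le_tail (a r p n k : ℕ) (hp : a = p + 2 * r) (hn : 1 ≤ n) (hk : r * n ≤ k)
    (hC : 6 * (a + 2) ≤ p * n) :
    ratfun a r n ((k + 1 : ℕ) : ℝ) ≤
      (Real.exp ((2 * r + 1) * (1 + Real.log 2) * n) * (n : ℝ) ^ (p * n) *
        (Real.exp (6 * ((a : ℝ) + 2)) * ((r : ℝ) + 3) ^ (6 * (a + 2)))) *
      (1 / ((k : ℝ) + n) ^ (p * n - 6 * (a + 2))) := by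
  have h2r : 2 * r ≤ a := by omega
  have hpa : (a : ℝ) - 2 * r = p := by rw [hp]; push_cast; ring
  have hn0 : (0 : ℝ) < n := by exact_mod_cast hn
  have hn1 : (1 : ℝ) ≤ n := by exact_mod_cast hn
  refine (ratfun_succ_le_exp a r n k h2r hn hk).trans ?_
  have hk0 : (0 : ℝ) ≤ k := Nat.cast_nonneg k
  have hkn : (r : ℝ) ≤ (k : ℝ) / n := by
    rw [le_div_iff₀ hn0]; exact_mod_cast hk
  have hkn0 : (0 : ℝ) < (k : ℝ) + n := by linarith
  set c₁ : ℝ := (2 * r + 1) * (1 + Real.log 2) with hc₁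
  set C : ℕ := 6 * (a + 2) with hCdef
  set E : ℝ := Real.exp (6 * ((a : ℝ) + 2)) with hE
  -- `exp(n Φ(k/n)) ≤ exp(c₁ n) n^{pn} / (k+n)^{pn}`
  have hΦ := Phi_le a r hkn
  rw [hpa] at hΦ
  have hlog : Real.log ((k : ℝ) / n + 1) = Real.log ((k : ℝ) + n) - Real.log n := by
    rw [← Real.log_div hkn0.ne' hn0.ne']; congr 1; field_simp
  rw [hlog] at hΦ
  have h1 : (n : ℝ) * Phi a r ((k : ℝ) / n) ≤
      c₁ * n - (p * n : ℕ) * (Real.log ((k : ℝ) + n) - Real.log n) := by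
    have := mul_le_mul_of_nonneg_left hΦ hn0.le
    push_cast
    nlinarith
  have e1 : Real.exp (n * Phi a r ((k : ℝ) / n)) ≤
      Real.exp (c₁ * n) * (n : ℝ) ^ (p * n) / ((k : ℝ) + n) ^ (p * n) := by
    calc Real.exp (n * Phi a r ((k : ℝ) / n))
        ≤ Real.exp (c₁ * n - (p * n : ℕ) * (Real.log ((k : ℝ) + n) - Real.log n)) :=
          Real.exp_le_exp.mpr h1
      _ = Real.exp (c₁ * n) * (n : ℝ) ^ (p * n) / ((k : ℝ) + n) ^ (p * n) := by
          rw [Real.exp_sub, mul_sub, Real.exp_sub, Real.exp_nat_mul, Real.exp_nat_mul,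
            Real.exp_log hkn0, Real.exp_log hn0]
          field_simp
  -- the polynomial factor: `k + (r+1)n + 2 ≤ (r+3)(k+n)`
  have hle : (k : ℝ) + (r + 1) * n + 2 ≤ ((r : ℝ) + 3) * ((k : ℝ) + n) := by nlinarith
  have e2 : ((k : ℝ) + (r + 1) * n + 2) ^ C ≤ (((r : ℝ) + 3) * ((k : ℝ) + n)) ^ C :=
    pow_le_pow_left₀ (by positivity) hle _
  have e3 : ((k : ℝ) + n) ^ C / ((k : ℝ) + n) ^ (p * n) = 1 / ((k : ℝ) + n) ^ (p * n - C) := by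
    have : ((k : ℝ) + n) ^ (p * n) = ((k : ℝ) + n) ^ (p * n - C) * ((k : ℝ) + n) ^ C := by
      rw [← pow_add]; congr 1; omega
    rw [this]
    field_simp
  calc Real.exp (n * Phi a r ((k : ℝ) / n)) * (E * ((k : ℝ) + (r + 1) * n + 2) ^ C)
      ≤ (Real.exp (c₁ * n) * (n : ℝ) ^ (p * n) / ((k : ℝ) + n) ^ (p * n)) *
          (E * (((r : ℝ) + 3) * ((k : ℝ) + n)) ^ C) :=
        mul_le_mul e1 (mul_le_mul_of_nonneg_left e2 (Real.exp_pos _).le) (by positivity)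
          (by positivity)
    _ = Real.exp (c₁ * n) * (n : ℝ) ^ (p * n) * (E * ((r : ℝ) + 3) ^ C) *
          (((k : ℝ) + n) ^ C / ((k : ℝ) + n) ^ (p * n)) := by
        rw [mul_pow]; ring
    _ = _ := by rw [e3]

/-- **Upper bound.** If `Φ ≤ M` on `[r, ∞)` then for every `ε > 0`, `S_n ≤ exp(n(M+ε))` for all
large `n`: the terms `k ≤ Kn` are each `≤ poly(n) e^{nM}`, and for `K` with
`(K+1)^{a-2r} ≥ e^{c₁ - M}` the tail `k > Kn` is `≤ poly(n) (e^{c₁}/(K+1)^{a-2r})^n ≤ poly(n) e^{nM}`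
by the decay of `Φ` and `∑_{j>N} j^{-s} ≤ N^{1-s}`. [cite: Rivoal2000, Lemme 3 (elementary form)] -/
theorem series_le_exp (a r : ℕ) (ha : 2 * r + 2 ≤ a) {M : ℝ}
    (hM : ∀ x : ℝ, (r : ℝ) ≤ x → Phi a r x ≤ M) {ε : ℝ} (hε : 0 < ε) :
    ∀ᶠ n : ℕ in atTop, series a r n ≤ Real.exp (n * (M + ε)) := by
  have h2r : 2 * r ≤ a := by omega
  obtain ⟨p, hp⟩ : ∃ p : ℕ, a = p + 2 * r := ⟨a - 2 * r, by omega⟩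
  have hp2 : 2 ≤ p := by omega
  set c₁ : ℝ := (2 * r + 1) * (1 + Real.log 2) with hc₁
  set C : ℕ := 6 * (a + 2) with hC
  set E : ℝ := Real.exp (6 * ((a : ℝ) + 2)) with hE
  have hE0 : 0 < E := Real.exp_pos _
  -- choice of `K`
  obtain ⟨K, hK⟩ : ∃ K : ℕ, Real.exp (c₁ - M) ≤ ((K : ℝ) + 1) ^ p := by
    refine ⟨⌈Real.exp (c₁ - M)⌉₊, ?_⟩
    have h0 : (0 : ℝ) ≤ ⌈Real.exp (c₁ - M)⌉₊ := Nat.cast_nonneg _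
    calc Real.exp (c₁ - M) ≤ ⌈Real.exp (c₁ - M)⌉₊ := Nat.le_ceil _
      _ ≤ (⌈Real.exp (c₁ - M)⌉₊ : ℝ) + 1 := by linarith
      _ ≤ ((⌈Real.exp (c₁ - M)⌉₊ : ℝ) + 1) ^ p := le_self_pow₀ (by linarith) (by omega)
  have hK0 : (0 : ℝ) < (K : ℝ) + 1 := by positivity
  have hK1 : Real.exp c₁ / ((K : ℝ) + 1) ^ p ≤ Real.exp M := by
    rw [div_le_iff₀ (by positivity)]
    calc Real.exp c₁ = Real.exp M * Real.exp (c₁ - M) := by rw [← Real.exp_add]; ring_nf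
      _ ≤ Real.exp M * ((K : ℝ) + 1) ^ p := mul_le_mul_of_nonneg_left hK (Real.exp_pos M).le
  -- the polynomial factor
  set A : ℝ := ((K : ℝ) + 1) * E * ((K : ℝ) + r + 3) ^ C +
    E * ((r : ℝ) + 3) ^ C * ((K : ℝ) + 1) ^ (C + 1) with hA
  have hA0 : 0 < A := by positivity
  have hQ := eventually_mul_pow_le_exp hA0 hε (C + 1)
  filter_upwards [hQ, eventually_ge_atTop 1, eventually_ge_atTop (C + 2)] with n hQn hn hnC
  have hn0 : (0 : ℝ) < n := by exact_mod_cast hn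
  have hn1 : (1 : ℝ) ≤ n := by exact_mod_cast hn
  have hpn : C + 2 ≤ p * n := le_trans hnC (Nat.le_mul_of_pos_left n (by omega))
  set B₁ : ℝ := Real.exp (n * M) * (E * (((K : ℝ) + r + 3) * n) ^ C) with hB₁
  set B₂ : ℝ := Real.exp (c₁ * n) * (n : ℝ) ^ (p * n) * (E * ((r : ℝ) + 3) ^ C) with hB₂
  have hB₁0 : 0 ≤ B₁ := by positivity
  have hB₂0 : 0 ≤ B₂ := by positivity
  -- partial sums
  have hpartial : ∀ N : ℕ, ∑ k ∈ range N, ratfun a r n ((k + 1 : ℕ) : ℝ) ≤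
      ((K * n : ℕ) + 1) * B₁ + B₂ * (1 / (((K * n : ℕ) : ℝ) + n) ^ (p * n - C - 1)) := by
    intro N
    refine sum_range_le_of_two_bounds (fun k => ratfun_succ_nonneg a r n k) hn
      (s := p * n - C) (by omega) hB₂0 (fun k hk => ?_) (fun k hk => ?_) N
    · exact ratfun_succ_le_head a r n k K hM h2r hn hk
    · rcases lt_or_ge k (r * n) with hlt | hge
      · rw [ratfun_nat_eq_zero a r n (k := k + 1) (by omega) (by omega)]; positivity
      · exact ratfun_succ_le_tail a r p n k hp hn hge (by omega)
  -- the total is `≤ A n^{C+1} e^{nM}`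
  have hKpow : Real.exp (c₁ * n) / ((K : ℝ) + 1) ^ (p * n) ≤ Real.exp (n * M) := by
    rw [pow_mul, mul_comm c₁, Real.exp_nat_mul, ← div_pow, Real.exp_nat_mul]
    exact pow_le_pow_left₀ (by positivity) hK1 n
  have hKn : (((K * n : ℕ) : ℝ) + n) = ((K : ℝ) + 1) * n := by push_cast; ring
  have t1 : (((K * n : ℕ) : ℝ) + 1) * B₁ ≤
      ((K : ℝ) + 1) * E * ((K : ℝ) + r + 3) ^ C * (n : ℝ) ^ (C + 1) * Real.exp (n * M) := by
    rw [hB₁, mul_pow, pow_succ]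
    have h1 : ((K * n : ℕ) : ℝ) + 1 ≤ ((K : ℝ) + 1) * n := by push_cast; nlinarith
    have h0 : 0 ≤ Real.exp (n * M) * (E * (((K : ℝ) + r + 3) ^ C * (n : ℝ) ^ C)) := by positivity
    calc (((K * n : ℕ) : ℝ) + 1) * (Real.exp (n * M) * (E * (((K : ℝ) + r + 3) ^ C * (n : ℝ) ^ C)))
        ≤ (((K : ℝ) + 1) * n) * (Real.exp (n * M) * (E * (((K : ℝ) + r + 3) ^ C * (n : ℝ) ^ C))) :=
          mul_le_mul_of_nonneg_right h1 h0
      _ = ((K : ℝ) + 1) * E * ((K : ℝ) + r + 3) ^ C * ((n : ℝ) ^ C * n) * Real.exp (n * M) := by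
          ring
  have t2 : B₂ * (1 / (((K * n : ℕ) : ℝ) + n) ^ (p * n - C - 1)) ≤
      E * ((r : ℝ) + 3) ^ C * ((K : ℝ) + 1) ^ (C + 1) * (n : ℝ) ^ (C + 1) * Real.exp (n * M) := by
    obtain ⟨q, hq⟩ : ∃ q, p * n = q + (C + 1) := ⟨p * n - (C + 1), by omega⟩
    have hq' : p * n - C - 1 = q := by omega
    rw [hq', hB₂, hq, hKn]
    have key : Real.exp (c₁ * n) * (n : ℝ) ^ (q + (C + 1)) * (E * ((r : ℝ) + 3) ^ C) *
        (1 / (((K : ℝ) + 1) * n) ^ q) =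
        E * ((r : ℝ) + 3) ^ C * ((K : ℝ) + 1) ^ (C + 1) * (n : ℝ) ^ (C + 1) *
          (Real.exp (c₁ * n) / ((K : ℝ) + 1) ^ (q + (C + 1))) := by
      simp only [mul_pow, pow_add]
      field_simp
    rw [key, ← hq]
    exact mul_le_mul_of_nonneg_left hKpow (by positivity)
  have htot : (((K * n : ℕ) : ℝ) + 1) * B₁ + B₂ * (1 / (((K * n : ℕ) : ℝ) + n) ^ (p * n - C - 1)) ≤
      A * (n : ℝ) ^ (C + 1) * Real.exp (n * M) := by
    calc _ ≤ _ := add_le_add t1 t2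
      _ = A * (n : ℝ) ^ (C + 1) * Real.exp (n * M) := by rw [hA]; ring
  have hbound : series a r n ≤ A * (n : ℝ) ^ (C + 1) * Real.exp (n * M) := by
    rw [series_eq]
    exact Real.tsum_le_of_sum_range_le (fun k => ratfun_succ_nonneg a r n k)
      fun N => (hpartial N).trans htot
  calc series a r n ≤ A * (n : ℝ) ^ (C + 1) * Real.exp (n * M) := hbound
    _ ≤ Real.exp (ε * n) * Real.exp (n * M) := mul_le_mul_of_nonneg_right hQn (Real.exp_pos _).le
    _ = Real.exp (n * (M + ε)) := by rw [← Real.exp_add]; ring_nf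

/-! ### The limit -/

/-- **Rivoal's Lemme 3 (elementary form).** For `2r + 2 ≤ a` the limit `s = lim_n S_n^{1/n}`
exists, namely `s = exp(sup_{x ≥ r} Φ_{a,r}(x))`, and `0 < s ≤ (2e)^{2r+1}/(r+1)^{a-2r}`.
(Rivoal 2000, Lemme 3, states existence with the sharper bound
`(2r+1)^{2r+1}(ra+r)^{ra+r}(a-2r)^{a-2r}/(ra+a-r)^{ra+a-r}`; by Fischler 2004, Remarque 2.10,
only existence and a bound of this quality are needed for Théorème 1.)
[cite: Rivoal2000, Lemme 3 (existence of the limit; weaker bound)] -/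
theorem tendsto_series_rpow (a r : ℕ) (ha : 2 * r + 2 ≤ a) :
    ∃ s : ℝ, 0 < s ∧
      s ≤ Real.exp ((2 * r + 1) * (1 + Real.log 2)) / ((r : ℝ) + 1) ^ (a - 2 * r) ∧
      Tendsto (fun n : ℕ => series a r n ^ (1 / (n : ℝ))) atTop (𝓝 s) := by
  have h2r : 2 * r ≤ a := by omega
  set M₀ : ℝ := -((a : ℝ) - 2 * r) * Real.log (r + 1) + (2 * r + 1) * (1 + Real.log 2) with hM₀
  set T : Set ℝ := Phi a r '' Set.Ici (r : ℝ) with hT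
  have hTne : T.Nonempty := ⟨Phi a r r, r, Set.mem_Ici.2 le_rfl, rfl⟩
  have hTbdd : BddAbove T := by
    refine ⟨M₀, ?_⟩
    rintro _ ⟨x, hx, rfl⟩
    exact Phi_le_const a r h2r hx
  set h : ℝ := sSup T with hh
  have hle : ∀ x : ℝ, (r : ℝ) ≤ x → Phi a r x ≤ h := fun x hx => le_csSup hTbdd ⟨x, hx, rfl⟩
  have hhM : h ≤ M₀ := csSup_le hTne (by rintro _ ⟨x, hx, rfl⟩; exact Phi_le_const a r h2r hx)
  -- `log S_n / n → h`
  have hlog : Tendsto (fun n : ℕ => Real.log (series a r n) / n) atTop (𝓝 h) := by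
    rw [tendsto_order]
    constructor
    · intro b hb
      obtain ⟨_, ⟨x₀, hx₀, rfl⟩, hbx⟩ := exists_lt_of_lt_csSup hTne hb
      have hε : 0 < (Phi a r x₀ - b) / 2 := by linarith
      filter_upwards [series_ge_exp a r ha hx₀ hε, eventually_ge_atTop 1] with n hn hn1
      have hn0 : (0 : ℝ) < n := by exact_mod_cast hn1
      have hpos := series_pos a r n hn1 ha
      have := Real.log_le_log (Real.exp_pos _) hn
      rw [Real.log_exp] at this
      rw [lt_div_iff₀ hn0]
      nlinarith
    · intro b hb
      have hε : 0 < (b - h) / 2 := by linarith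
      filter_upwards [series_le_exp a r ha hle hε, eventually_ge_atTop 1] with n hn hn1
      have hn0 : (0 : ℝ) < n := by exact_mod_cast hn1
      have hpos := series_pos a r n hn1 ha
      have := Real.log_le_log hpos hn
      rw [Real.log_exp] at this
      rw [div_lt_iff₀ hn0]
      nlinarith
  refine ⟨Real.exp h, Real.exp_pos h, ?_, ?_⟩
  · have : Real.exp M₀ = Real.exp ((2 * r + 1) * (1 + Real.log 2)) / ((r : ℝ) + 1) ^ (a - 2 * r) := by
      rw [hM₀, neg_mul, ← sub_eq_neg_add, Real.exp_sub, show (a : ℝ) - 2 * r = ((a - 2 * r : ℕ) : ℝ) by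
        rw [Nat.cast_sub h2r]; push_cast; ring, Real.exp_nat_mul, Real.exp_log (by positivity)]
    rw [← this]
    exact Real.exp_le_exp.mpr hhM
  · have hexp := (Real.continuous_exp.tendsto h).comp hlog
    refine hexp.congr' ?_
    filter_upwards [eventually_ge_atTop 1] with n hn
    have hpos := series_pos a r n hn ha
    simp only [Function.comp_apply]
    rw [Real.rpow_def_of_pos hpos, div_eq_mul_one_div]

end RivoalSeries

end Literature.NumberTheory.Transcendental
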